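import Summits.QuantumFields.YangMills.Theorems.LangevinControlUVOSLegsFromFemtoAndGapStubAssemblyRPLimit
import Summits.QuantumFields.YangMills.Theorems.MirrorModularBoostsHypercubicLimitClosureHalvesDefs
import Summits.QuantumFields.YangMills.Theorems.LangevinControlUVOSLegsAtWeakCouplingCDefs
import HarnessLib

/-!
# Crux `WeakCouplingHypercubicLimit` (stmt-QuantumFields-16120), line `Sketch`, r10 toolkit: the reflection pairing
of two smeared plane-string fields as plane-string lattice distributions (sub-goals SG-B1 `rpPair_expansion`,
SG-B3 `rpShifted_eq_latticeDistStr`)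

Helper file of the lead (c4) for the r10 skeleton `Cruxes/WeakCouplingHypercubicLimit/Lines/Sketch.lean`.  On the
odd torus of side `2L+1` the RP-spectral clustering hypothesis is consumed through the torus pairing
`E[conj Y(ΘU) · Y'(U)]` of two smeared multi-point plane-string fields `Y = fieldObs a Fᵢ m`, `Y' = fieldObs a Fⱼ m`
(OSLegs toolkit XVII, `LangevinControlUVOSLegsFromFemtoAndGapStubAssemblyRPObservable`).  The two identities of this
file turn it into a finite sum of plane-string lattice distributions `latticeDistStr` applied to ONE Schwartz
function, exactly as the E2 leg of `OSLegsFromFemtoAndGap` did for the square of one family (toolkits XVIII–XX), but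
for two different test functions and without the defect estimate:

* `rpPair_expansion` (SG-B1): the two-function form of toolkit XVIII's `wilsonExpectation_rpSquare_eq` —
  `E[conj Y(ΘU) Y'(U)] = Σ_{q,p} Σ_{x,y} conj Fᵢ(a x) Fⱼ(a y) · W^{q ++ p}(θ̃x ++ y)` (reflection law of the strings,
  product of two strings = appended string, Fubini for finite sums);
* `rpShifted_eq_latticeDistStr` (SG-B3): after the reindexing of toolkit XIX (`rpTerm_eq_shifted`), the `(q, p)` term
  is `latticeDistStr^{q ++ p}` of the appended tensor `Θ(τ_c Fᵢ)* ⊗ Fⱼ`, where `τ_c` is the slot-wise time shift by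
  `c_l = a (1 − [q (rev l) temporal]) e₀` (`SchwartzMap.compSubConstCLM`) and `Θ(·)*` the OS adjoint `osAdjoint`.

Refs: OsterwalderSeiler1978 §§2–3; GlimmJaffe1987 §6.1.
-/

noncomputable section

open scoped SchwartzMap BigOperators ComplexConjugate
open MeasureTheory Filter Topology
open Literature.MathematicalPhysics.QuantumFieldTheory Literature.MathematicalPhysics.QuantumLattice
open Literature.MathematicalPhysics.AQFT
open Literature.Probability.LatticeModels (box Site)
open Summit.QuantumFields.YangMills.Cruxes.HypercubicLimit.CouplingResponse
open Summit.QuantumFields.YangMills.Cruxes.OSLegsFromFemtoAndGap.DlrCollarTransfer (plane conn Decay RPPos ConnCS)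
open Summit.QuantumFields.YangMills.Cruxes.OSLegsAtWeakCouplingC.Sketch (Separated)
open Summit.QuantumFields.YangMills.Theorems.OSLegsFromFemtoAndGap

namespace Summit.QuantumFields.YangMills.Theorems.WeakCouplingHypercubicLimit.TraceNormColdPressure

/-! ### SG-B1: expansion of the reflection pairing into plane-string weights -/

/-- **SG-B1: the reflection pairing of two smeared fields, expanded** (two-function form of toolkit XVIII's
`wilsonExpectation_rpSquare_eq`): `E[conj Y(ΘU) · Y'(U)] = Σ_{q,p} Σ_{x,y} conj Fᵢ(a x) Fⱼ(a y) W^{q ++ p}(θ̃x ++ y)`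
with `W` the string weight `torusMomentStr` (normalisations `m`) and `θ̃` the orientation-dependent reflected sites
`thetaSite`. -/
theorem rpPair_expansion :
    ∀ (G : Type) [Group G] [TopologicalSpace G] [IsTopologicalGroup G] [CompactSpace G]
      [MeasurableSpace G] [BorelSpace G] (r : LatticeRep G) (β : ℝ) (L : ℕ) (a : ℝ) (n k : ℕ)
      (Fi : 𝓢((Fin n → EuclideanSpace ℝ (Fin 4)), ℂ)) (Fj : 𝓢((Fin k → EuclideanSpace ℝ (Fin 4)), ℂ))
      (m : Fin 4 × Fin 4 → ℝ),
      wilsonExpectation (d := 4) (L := 2 * L + 1) r.ρ β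
          (fun U => conj (fieldObs r L a Fi m U.timeReflect) * fieldObs r L a Fj m U) =
        ∑ q ∈ Fintype.piFinset (fun _ : Fin n => Finset.univ.filter fun pl : Fin 4 × Fin 4 => pl.1 < pl.2),
        ∑ p ∈ Fintype.piFinset (fun _ : Fin k => Finset.univ.filter fun pl : Fin 4 × Fin 4 => pl.1 < pl.2),
        ∑ x ∈ Fintype.piFinset (fun _ : Fin n => box 4 L),
        ∑ y ∈ Fintype.piFinset (fun _ : Fin k => box 4 L),
          conj (Fi (fun l => a • siteToE (x l))) * Fj (fun l => a • siteToE (y l)) *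
            (torusMomentStr r.ρ β L
              (fun l U => plaquetteObs r.ρ 0 (Fin.append q p l).1 (Fin.append q p l).2 U)
              (Fin.append (fun l => m (q l)) (fun l => m (p l)))
              (Fin.append (fun l => thetaSite (q l) (x l)) y) : ℂ) := by
  intro G _ _ _ _ _ _ r β L a n k Fi Fj m
  classical
  -- Step 1: the integrand, pointwise, as a four-fold finite sum (reflection law of the strings on the left factor)
  have hpt : ∀ U : GaugeConfig 4 (2 * L + 1) G,
      conj (fieldObs r L a Fi m U.timeReflect) * fieldObs r L a Fj m U =
        ∑ q ∈ Fintype.piFinset (fun _ : Fin n => Finset.univ.filter fun pl : Fin 4 × Fin 4 => pl.1 < pl.2),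
        ∑ p ∈ Fintype.piFinset (fun _ : Fin k => Finset.univ.filter fun pl : Fin 4 × Fin 4 => pl.1 < pl.2),
        ∑ x ∈ Fintype.piFinset (fun _ : Fin n => box 4 L),
        ∑ y ∈ Fintype.piFinset (fun _ : Fin k => box 4 L),
          conj (Fi (fun l => a • siteToE (x l))) * Fj (fun l => a • siteToE (y l)) *
            ((strObs r L q (fun l => m (q l)) (fun l => thetaSite (q l) (x l)) U *
              strObs r L p (fun l => m (p l)) y U : ℝ) : ℂ) := by
    intro U
    unfold fieldObs
    simp only [map_sum]
    rw [Finset.sum_mul]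
    refine Finset.sum_congr rfl fun q hq => ?_
    rw [Finset.mul_sum]
    refine Finset.sum_congr rfl fun p _ => ?_
    rw [Finset.sum_mul]
    refine Finset.sum_congr rfl fun x _ => ?_
    rw [Finset.mul_sum]
    refine Finset.sum_congr rfl fun y _ => ?_
    rw [map_mul, Complex.conj_ofReal, strObs_timeReflect r L ((mem_planeStrings_iff'' q).1 hq)]
    push_cast
    ring
  -- Step 2: integrate termwise; Step 3: each term is the string weight of the appended string
  unfold wilsonExpectation
  simp_rw [hpt]
  rw [integral_finsetSum _ (fun q _ => ?_)]
  · refine Finset.sum_congr rfl fun q _ => ?_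
    rw [integral_finsetSum _ (fun p _ => ?_)]
    · refine Finset.sum_congr rfl fun p _ => ?_
      rw [integral_finsetSum _ (fun x _ => ?_)]
      · refine Finset.sum_congr rfl fun x _ => ?_
        rw [integral_finsetSum _ (fun y _ => ?_)]
        · refine Finset.sum_congr rfl fun y _ => ?_
          rw [integral_const_mul]
          congr 1
          simp_rw [strObs_mul_strObs]
          have hI : ∫ U, ((strObs r L (Fin.append q p) (Fin.append (fun l => m (q l)) (fun l => m (p l)))
              (Fin.append (fun l => thetaSite (q l) (x l)) y) U : ℝ) : ℂ) ∂(wilsonMeasure (d := 4) (L := 2 * L + 1) r.ρ β) =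
              ((∫ U, strObs r L (Fin.append q p) (Fin.append (fun l => m (q l)) (fun l => m (p l)))
                (Fin.append (fun l => thetaSite (q l) (x l)) y) U ∂(wilsonMeasure (d := 4) (L := 2 * L + 1) r.ρ β) : ℝ) : ℂ) :=
            integral_ofReal
          rw [hI, integral_strObs]
        · exact integrable_rpTerm r β L _ q p _ _ _ _
      · exact integrable_finsetSum _ fun y _ => integrable_rpTerm r β L _ q p _ _ _ _
    · exact integrable_finsetSum _ fun x _ => integrable_finsetSum _ fun y _ => integrable_rpTerm r β L _ q p _ _ _ _
  · exact integrable_finsetSum _ fun p _ => integrable_finsetSum _ fun x _ => integrable_finsetSum _ fun y _ =>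
      integrable_rpTerm r β L _ q p _ _ _ _

/-! ### SG-B3: the reindexed term as a plane-string lattice distribution of one Schwartz function -/

/-- **SG-B3: the reindexed (shifted) pairing term is the plane-string lattice distribution of ONE Schwartz function** —
the OS adjoint of the slot-wise time-shifted `Fi` (shift `c_l = a (1 − [q (rev l) temporal]) e₀`, implemented by
`SchwartzMap.compSubConstCLM` with the constant `−c`), tensored with `Fj`: unfold `latticeDistStr` (`latticeDistStr_apply`),
split the appended multi-site sum (`sum_piFinset_append`) and evaluate the appended tensor. -/
theorem rpShifted_eq_latticeDistStr :
    ∀ (G : Type) [Group G] [TopologicalSpace G] [IsTopologicalGroup G] [CompactSpace G]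
      [MeasurableSpace G] [BorelSpace G] (r : LatticeRep G) (β : ℝ) (L : ℕ) (a : ℝ) (n k : ℕ)
      (q : Fin n → Fin 4 × Fin 4) (p : Fin k → Fin 4 × Fin 4)
      (Fi : 𝓢((Fin n → EuclideanSpace ℝ (Fin 4)), ℂ)) (Fj : 𝓢((Fin k → EuclideanSpace ℝ (Fin 4)), ℂ))
      (m : Fin 4 × Fin 4 → ℝ),
      ∑ x ∈ Fintype.piFinset (fun _ : Fin n => box 4 L),
      ∑ y ∈ Fintype.piFinset (fun _ : Fin k => box 4 L),
        conj (Fi (fun l => timeReflection 4 (a • siteToE (x (Fin.rev l))) +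
            (a * (1 - if (q (Fin.rev l)).1 = 0 then 1 else 0)) • siteToE (Pi.single (0 : Fin 4) (1 : ℤ)))) *
          Fj (fun l => a • siteToE (y l)) *
          (torusMomentStr r.ρ β L (fun l U => plaquetteObs r.ρ 0 (Fin.append q p l).1 (Fin.append q p l).2 U)
            (Fin.append (fun l => m (q l)) (fun l => m (p l))) (Fin.append x y) : ℂ) =
      latticeDistStr r.ρ β L a (fun l U => plaquetteObs r.ρ 0 (Fin.append q p l).1 (Fin.append q p l).2 U)
        (Fin.append (fun l => m (q l)) (fun l => m (p l)))
        ((osAdjoint (SchwartzMap.compSubConstCLM ℂ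
            (fun l : Fin n => -((a * (1 - if (q (Fin.rev l)).1 = 0 then 1 else 0)) • siteToE (Pi.single (0 : Fin 4) (1 : ℤ))))
            Fi)).appendTensor Fj) := by
  intro G _ _ _ _ _ _ r β L a n k q p Fi Fj m
  rw [latticeDistStr_apply, sum_piFinset_append]
  refine Finset.sum_congr rfl fun x _ => Finset.sum_congr rfl fun y _ => ?_
  rw [SchwartzMap.appendTensor_apply, osAdjoint_apply, SchwartzMap.compSubConstCLM_apply]
  simp only [Function.comp_def, Fin.append_left, Fin.append_right, Pi.sub_def, sub_neg_eq_add]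
  ring

end Summit.QuantumFields.YangMills.Theorems.WeakCouplingHypercubicLimit.TraceNormColdPressure

end
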